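import Summits.PneNP.PneNP.Theorems.RegularResolutionRung.Negative.OneSidedFalse
import Summits.PneNP.PneNP.Theorems.RamseyUncertifiableRegularResolutionRungBanksDefs
import Literature.Computability.AlgebraicComplexity.RandomRestrictionCounting
import Mathlib.Analysis.SpecialFunctions.Log.Base
import Mathlib.Analysis.SpecialFunctions.Pow.Real

/-!
# Route RamseyUncertifiable, crux `RegularResolutionRung` (stmt-PneNP-9818), line `indelible-zero-banks`:
stub `stub_oneWidthNF` (the ONE-WIDTH NORMAL FORM)

The registered stub `stub_oneWidthNF` of the line: GIVEN the restriction lemma with provenance (the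
neighbouring stub `stub_restrict`, taken here as the hypothesis `hR` and used, not proved), for
`0 < τ < 1`, `γ > 0` there are `ε₁ > 0` and `m₁` such that every regular refutation `π` of the unary
clique CNF `Clique(adj, k)` on `m ≥ m₁` vertices with `log₂ |π| ≤ ε₁ log₂² m` restricts to an induced
instance on `a` vertices, `(1-τ) log₂ m ≤ log₂ a`, carrying a regular refutation `π'`, `|π'| ≤ |π|`,
ALL of whose clauses have one-width (`|negSupport|`) at most `γ log₂ a`.

Proof (probabilistic method / union bound, fully proved here; constants `ε₁ = γτ(1-τ)/4`,
`m₁ = max 1 ⌈2^{2/τ}⌉`):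

* `a := ⌈m^{1-τ}⌉` (`oneWidthNF_exists_size`), fatness threshold `h := ⌊γ(1-τ) log₂ m⌋ + 1`
  (`oneWidthNF_exists_threshold`);
* the family `F` of negative supports of lines of `π` of size `≥ h` has `|F| ≤ |π|`; an `a`-subset of
  `Fin m` containing a fixed `h`-set is at most a `(a/m)^h` fraction of all `C(m,a)` of them (the tree's
  `KumarSaraf.card_powersetCard_filter_superset_mul_le`), so if `|π| · a^h < m^h` some `a`-set `A`
  contains no member of `F` (`oneWidthNF_exists_evading_set`);
* `|π| · a^h < m^h` follows from `log₂ |π| ≤ ε₁ log₂² m`, `log₂ a ≤ 1 + (1-τ) log₂ m` and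
  `log₂ m ≥ 2/τ` (`oneWidthNF_key_ineq`);
* restrict along the increasing enumeration `e` of `A` (`Finset.orderEmbOfFin`) using `hR`: every line
  of `π'` descends from a line of `π` whose negative support lies inside `A`, hence is not fat, hence has
  size `≤ h - 1 ≤ γ(1-τ) log₂ m ≤ γ log₂ a`.

All statements live in the namespace of the line's vocabulary
(`Theorems/RamseyUncertifiableRegularResolutionRungBanksDefs.lean`, `negSupport`).
-/

open scoped BigOperators

set_option linter.dupNamespace false -- Summit.PneNP.PneNP: single-conjunct summit

namespace Summit.PneNP.PneNP.Cruxes.RegularResolutionRung.IndelibleZeroBanks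

open Finset
open Literature.Computability.MetaComplexity Literature.Computability.Complexity
open Summit.PneNP.PneNP.Theorems.RegularResolutionRung.Negative (cliqueCNF)
open Literature.Computability.AlgebraicComplexity.KumarSaraf
  (card_powersetCard_filter_superset_mul_le)

/-! ## Counting: an `a`-set evading a small family of fat sets -/

/-- **Union bound.** If `F` is a family of subsets of `Fin m`, each of size `≥ h`, `a ≤ m` and
`|F| · a^h < m^h`, then some `a`-subset of `Fin m` contains no member of `F`: the `a`-sets containing
a fixed `h`-set number at most `C(m,a) · (a/m)^h`
(`KumarSaraf.card_powersetCard_filter_superset_mul_le`), and `|F| · C(m,a) · (a/m)^h < C(m,a)`. -/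
theorem oneWidthNF_exists_evading_set {m a h : ℕ} (ham : a ≤ m) (F : Finset (Finset (Fin m)))
    (hF : ∀ W ∈ F, h ≤ W.card) (hlt : F.card * a ^ h < m ^ h) :
    ∃ A : Finset (Fin m), A.card = a ∧ ∀ W ∈ F, ¬ W ⊆ A := by
  have hPcard : (powersetCard a (univ : Finset (Fin m))).card = m.choose a := by
    rw [card_powersetCard, card_univ, Fintype.card_fin]
  have hbad : ∀ W ∈ F,
      ((powersetCard a (univ : Finset (Fin m))).filter fun A => W ⊆ A).card * m ^ h ≤
        m.choose a * a ^ h := by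
    intro W hW
    obtain ⟨S, hSW, hS⟩ := exists_subset_card_eq (hF W hW)
    have hmono : ((powersetCard a (univ : Finset (Fin m))).filter fun A => W ⊆ A) ⊆
        ((powersetCard a (univ : Finset (Fin m))).filter fun A => S ⊆ A) := by
      intro A hA
      rw [mem_filter] at hA ⊢
      exact ⟨hA.1, hSW.trans hA.2⟩
    have key := card_powersetCard_filter_superset_mul_le (univ : Finset (Fin m)) S a
    rw [card_univ, Fintype.card_fin, hS] at key
    exact (Nat.mul_le_mul_right _ (card_le_card hmono)).trans key
  have hU : (F.biUnion fun W =>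
        (powersetCard a (univ : Finset (Fin m))).filter fun A => W ⊆ A).card * m ^ h <
      (powersetCard a (univ : Finset (Fin m))).card * m ^ h :=
    calc (F.biUnion fun W =>
            (powersetCard a (univ : Finset (Fin m))).filter fun A => W ⊆ A).card * m ^ h
        ≤ (∑ W ∈ F, ((powersetCard a (univ : Finset (Fin m))).filter fun A => W ⊆ A).card) *
            m ^ h := Nat.mul_le_mul_right _ card_biUnion_le
      _ = ∑ W ∈ F, ((powersetCard a (univ : Finset (Fin m))).filter fun A => W ⊆ A).card *
            m ^ h := sum_mul _ _ _
      _ ≤ ∑ _W ∈ F, m.choose a * a ^ h := sum_le_sum hbad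
      _ = m.choose a * (F.card * a ^ h) := by rw [sum_const, smul_eq_mul]; ring
      _ < m.choose a * m ^ h := mul_lt_mul_of_pos_left hlt (Nat.choose_pos ham)
      _ = (powersetCard a (univ : Finset (Fin m))).card * m ^ h := by rw [hPcard]
  obtain ⟨A, hAP, hAU⟩ :=
    exists_mem_notMem_of_card_lt_card (lt_of_mul_lt_mul_right hU (Nat.zero_le _))
  refine ⟨A, (mem_powersetCard.1 hAP).2, fun W hW hWA => hAU ?_⟩
  exact mem_biUnion.2 ⟨W, hW, mem_filter.2 ⟨hAP, hWA⟩⟩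

/-! ## Parameters and arithmetic -/

/-- From `⌈2^x⌉₊ ≤ n` conclude `x ≤ log₂ n`. -/
theorem oneWidthNF_le_logb_of_ceil_rpow_le {x : ℝ} {n : ℕ} (h : ⌈(2 : ℝ) ^ x⌉₊ ≤ n) :
    x ≤ Real.logb 2 (n : ℝ) := by
  have hx : (0 : ℝ) < (2 : ℝ) ^ x := by positivity
  have h1 : (2 : ℝ) ^ x ≤ (n : ℝ) := (Nat.le_ceil _).trans (by exact_mod_cast h)
  have hn : (0 : ℝ) < (n : ℝ) := hx.trans_le h1
  exact (Real.le_logb_iff_rpow_le one_lt_two hn).2 h1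

/-- The size `a := ⌈m^{1-τ}⌉` of the induced instance (`0 ≤ τ ≤ 1`, `m ≥ 1`): `a ≤ m`, `a ≥ 1`,
`(1-τ) log₂ m ≤ log₂ a ≤ 1 + (1-τ) log₂ m`. -/
theorem oneWidthNF_exists_size {τ : ℝ} (hτ : 0 ≤ τ) (hτ1 : τ ≤ 1) {m : ℕ} (hm : 1 ≤ m) :
    ∃ a : ℕ, a ≤ m ∧ (1 : ℝ) ≤ a ∧ (1 - τ) * Real.logb 2 m ≤ Real.logb 2 a ∧
      Real.logb 2 a ≤ 1 + (1 - τ) * Real.logb 2 m := by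
  have hM : (1 : ℝ) ≤ m := by exact_mod_cast hm
  have hM0 : (0 : ℝ) < m := by positivity
  have hx1 : (1 : ℝ) ≤ (m : ℝ) ^ (1 - τ) := Real.one_le_rpow hM (by linarith)
  have hx0 : (0 : ℝ) < (m : ℝ) ^ (1 - τ) := by positivity
  have hxm : (m : ℝ) ^ (1 - τ) ≤ m :=
    calc (m : ℝ) ^ (1 - τ) ≤ (m : ℝ) ^ (1 : ℝ) :=
          Real.rpow_le_rpow_of_exponent_le hM (by linarith)
      _ = m := Real.rpow_one _
  have hlogx : Real.logb 2 ((m : ℝ) ^ (1 - τ)) = (1 - τ) * Real.logb 2 m :=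
    Real.logb_rpow_eq_mul_logb_of_pos hM0
  have hc_ge : (m : ℝ) ^ (1 - τ) ≤ ((⌈(m : ℝ) ^ (1 - τ)⌉₊ : ℕ) : ℝ) := Nat.le_ceil _
  have hc_lt : ((⌈(m : ℝ) ^ (1 - τ)⌉₊ : ℕ) : ℝ) < (m : ℝ) ^ (1 - τ) + 1 :=
    Nat.ceil_lt_add_one hx0.le
  refine ⟨⌈(m : ℝ) ^ (1 - τ)⌉₊, Nat.ceil_le.2 hxm, hx1.trans hc_ge, ?_, ?_⟩
  · rw [← hlogx]
    exact Real.logb_le_logb_of_le one_lt_two hx0 hc_ge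
  · calc Real.logb 2 ((⌈(m : ℝ) ^ (1 - τ)⌉₊ : ℕ) : ℝ)
          ≤ Real.logb 2 (2 * (m : ℝ) ^ (1 - τ)) :=
            Real.logb_le_logb_of_le one_lt_two (hx0.trans_le hc_ge) (by linarith)
      _ = 1 + (1 - τ) * Real.logb 2 m := by
            rw [Real.logb_mul two_ne_zero hx0.ne', Real.logb_self_eq_one one_lt_two, hlogx]

/-- The fatness threshold `h := ⌊g⌋ + 1` (`g = γ(1-τ) log₂ m ≥ 0`): `g < h ≤ g + 1`. -/
theorem oneWidthNF_exists_threshold {g : ℝ} (hg : 0 ≤ g) :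
    ∃ h : ℕ, g < h ∧ (h : ℝ) ≤ g + 1 :=
  ⟨⌊g⌋₊ + 1, by push_cast; exact Nat.lt_floor_add_one g,
    by push_cast; linarith [Nat.floor_le hg]⟩

/-- The arithmetic heart of the union bound: with `ε₁ = γτ(1-τ)/4`, `L = log₂ m ≥ 2/τ` and
`H > γ(1-τ)L` (the threshold), `ε₁ L² + H (1 + (1-τ) L) < H L`, i.e. `ε₁ L² < H (τL - 1)`:
indeed `H(τL-1) - ε₁L² = (H - γ(1-τ)L)(τL-1) + γ(1-τ)L(¾τL - 1) > 0`. -/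
theorem oneWidthNF_key_ineq {τ γ L H : ℝ} (hτ : 0 < τ) (hγ : 0 ≤ γ) (hτ1 : τ ≤ 1)
    (hL : 2 / τ ≤ L) (hH : γ * (1 - τ) * L < H) :
    γ * τ * (1 - τ) / 4 * L ^ 2 + H * (1 + (1 - τ) * L) < H * L := by
  have hτL : 2 ≤ τ * L := by
    have h2 := (div_le_iff₀ hτ).1 hL
    linarith [mul_comm L τ]
  have hL0 : 0 ≤ L := le_trans (div_pos two_pos hτ).le hL
  have h1τ : 0 ≤ 1 - τ := by linarith
  have hg : 0 ≤ γ * (1 - τ) * L := mul_nonneg (mul_nonneg hγ h1τ) hL0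
  have h1 : 0 < (H - γ * (1 - τ) * L) * (τ * L - 1) := mul_pos (sub_pos.2 hH) (by linarith)
  have h2 : 0 ≤ γ * (1 - τ) * L * (3 / 4 * (τ * L) - 1) := mul_nonneg hg (by linarith)
  nlinarith [h1, h2]

/-! ## The stub -/

/-- **stub_oneWidthNF** (S4 of the line `indelible-zero-banks`; probabilistic method). GIVEN the
restriction lemma with provenance (hypothesis = the registered statement of `stub_restrict`), for
`0 < τ < 1`, `γ > 0` there are `ε₁ > 0` (`:= γτ(1-τ)/4`) and `m₁` (`:= max 1 ⌈2^{2/τ}⌉`) such that every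
regular refutation `π` of `Clique(adj,k)` on `m ≥ m₁` vertices with `log₂|π| ≤ ε₁ log₂² m` restricts to an
induced instance on `a` vertices, `(1-τ) log₂ m ≤ log₂ a`, with a regular refutation `π'`, `|π'| ≤ |π|`,
all of whose clauses have one-width `≤ γ log₂ a`. Proof: `a := ⌈m^{1-τ}⌉`, `h := ⌊γ(1-τ)log₂ m⌋ + 1`; the
negative supports of lines of `π` of size `≥ h` form a family `F`, `|F| ≤ |π|`, and `|π| · a^h < m^h`
(`oneWidthNF_key_ineq`), so an `a`-set `A` evading `F` exists (`oneWidthNF_exists_evading_set`); restrict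
along the enumeration of `A`: a line of `π'` descends from a line of `π` with negative support inside
`A`, hence of size `< h`, hence `≤ γ(1-τ) log₂ m ≤ γ log₂ a`. -/
theorem stub_oneWidthNF :
    (∀ (n a k : ℕ) (adj : Fin n → Fin n → Bool) (e : Fin a ↪ Fin n) (π : List (ResLine ℕ)),
      IsResRefutation (cliqueCNF n k adj) π → IsRegular π →
      ∃ π' : List (ResLine ℕ),
      IsResRefutation (cliqueCNF a k fun u v => adj (e u) (e v)) π' ∧ IsRegular π' ∧
      π'.length ≤ π.length ∧
      ∀ l' ∈ π', ∃ l ∈ π,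
      (negSupport a k l'.clause).card ≤ (negSupport n k l.clause).card ∧
      ∀ v ∈ negSupport n k l.clause, v ∈ Set.range e) →
    ∀ τ γ : ℝ, 0 < τ → τ < 1 → 0 < γ → ∃ ε₁ : ℝ, 0 < ε₁ ∧ ∃ m₁ : ℕ, ∀ m : ℕ, m₁ ≤ m →
    ∀ (adj : Fin m → Fin m → Bool) (k : ℕ) (π : List (ResLine ℕ)),
    IsResRefutation (cliqueCNF m k adj) π → IsRegular π →
    Real.logb 2 π.length ≤ ε₁ * Real.logb 2 m ^ 2 →
    ∃ (a : ℕ) (e : Fin a ↪ Fin m) (π' : List (ResLine ℕ)),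
    (1 - τ) * Real.logb 2 m ≤ Real.logb 2 a ∧
    IsResRefutation (cliqueCNF a k fun u v => adj (e u) (e v)) π' ∧ IsRegular π' ∧
    π'.length ≤ π.length ∧
    ∀ l ∈ π', ((negSupport a k l.clause).card : ℝ) ≤ γ * Real.logb 2 a := by
  intro hR τ γ hτ hτ1 hγ
  have h1τ : 0 < 1 - τ := by linarith
  refine ⟨γ * τ * (1 - τ) / 4, div_pos (mul_pos (mul_pos hγ hτ) h1τ) four_pos,
    max 1 ⌈(2 : ℝ) ^ (2 / τ)⌉₊, ?_⟩
  intro m hm adj k π hπ hreg hlen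
  have hm1 : 1 ≤ m := le_of_max_le_left hm
  have hL : 2 / τ ≤ Real.logb 2 m :=
    oneWidthNF_le_logb_of_ceil_rpow_le (le_of_max_le_right hm)
  have hL0 : 0 ≤ Real.logb 2 (m : ℝ) := le_trans (div_pos two_pos hτ).le hL
  obtain ⟨a, ham, ha1, hloga, hloga'⟩ := oneWidthNF_exists_size hτ.le hτ1.le hm1
  obtain ⟨h, hgh, hhg⟩ := oneWidthNF_exists_threshold
    (mul_nonneg (mul_nonneg hγ.le h1τ.le) hL0 : 0 ≤ γ * (1 - τ) * Real.logb 2 m)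
  -- the numeric criterion `|π| · a^h < m^h`
  have hp : 0 < π.length := by
    obtain ⟨l, hl, -⟩ := hπ.2
    exact List.length_pos_of_mem hl
  have hcrit : π.length * a ^ h < m ^ h := by
    have hP0 : (0 : ℝ) < π.length := by exact_mod_cast hp
    have hA0 : (0 : ℝ) < a := by linarith
    have hM0 : (0 : ℝ) < m := by exact_mod_cast hm1
    have key := oneWidthNF_key_ineq hτ hγ.le hτ1.le hL hgh
    have h1 : Real.logb 2 ((π.length : ℝ) * (a : ℝ) ^ h) < Real.logb 2 ((m : ℝ) ^ h) := by
      rw [Real.logb_mul hP0.ne' (pow_pos hA0 h).ne', Real.logb_pow, Real.logb_pow]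
      calc Real.logb 2 π.length + h * Real.logb 2 a
          ≤ γ * τ * (1 - τ) / 4 * Real.logb 2 m ^ 2 + h * (1 + (1 - τ) * Real.logb 2 m) :=
            add_le_add hlen (mul_le_mul_of_nonneg_left hloga' (Nat.cast_nonneg h))
        _ < h * Real.logb 2 m := key
    have h2 := (Real.logb_lt_logb_iff one_lt_two (mul_pos hP0 (pow_pos hA0 h))
      (pow_pos hM0 h)).1 h1
    exact_mod_cast h2
  -- the fat family `F` and an `a`-set `A` evading it
  obtain ⟨A, hAcard, hAev⟩ := oneWidthNF_exists_evading_set ham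
    (((π.map fun l => negSupport m k l.clause).toFinset).filter fun W => h ≤ W.card)
    (fun W hW => (mem_filter.1 hW).2)
    (lt_of_le_of_lt (Nat.mul_le_mul_right _ ((card_filter_le _ _).trans
      ((List.toFinset_card_le _).trans (List.length_map ..).le))) hcrit)
  -- the embedding enumerating `A`, and the restriction
  obtain ⟨e, he⟩ : ∃ e : Fin a ↪ Fin m, ∀ v, v ∈ Set.range e ↔ v ∈ A :=
    ⟨(A.orderEmbOfFin hAcard).toEmbedding, fun v => by simp⟩
  obtain ⟨π', hπ', hreg', hlen', hprov⟩ := hR m a k adj e π hπ hreg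
  refine ⟨a, e, π', hloga, hπ', hreg', hlen', fun l' hl' => ?_⟩
  obtain ⟨l, hl, hcard, hsub⟩ := hprov l' hl'
  have hlt : (negSupport m k l.clause).card < h := by
    by_contra hge
    refine hAev (negSupport m k l.clause) ?_ fun v hv => (he v).1 (hsub v hv)
    rw [mem_filter, List.mem_toFinset, List.mem_map]
    exact ⟨⟨l, hl, rfl⟩, not_lt.1 hge⟩
  have hle : ((negSupport a k l'.clause).card : ℝ) + 1 ≤ h := by
    exact_mod_cast Nat.succ_le_of_lt (hcard.trans_lt hlt)
  calc ((negSupport a k l'.clause).card : ℝ) ≤ γ * (1 - τ) * Real.logb 2 m := by linarith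
    _ = γ * ((1 - τ) * Real.logb 2 m) := by ring
    _ ≤ γ * Real.logb 2 a := mul_le_mul_of_nonneg_left hloga hγ.le

/-- **Anchor** (registered sub-goal `oneWidthNF_anchor` of stmt-PneNP-9818): the statement of
`stub_oneWidthNF` once more, verbatim (the skeleton registers `stub_oneWidthNF` through its local
abbreviations `Restrict → OneWidthNF`; this closed form is their expansion). -/
theorem oneWidthNF_anchor :
    (∀ (n a k : ℕ) (adj : Fin n → Fin n → Bool) (e : Fin a ↪ Fin n) (π : List (ResLine ℕ)),
      IsResRefutation (cliqueCNF n k adj) π → IsRegular π →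
      ∃ π' : List (ResLine ℕ),
      IsResRefutation (cliqueCNF a k fun u v => adj (e u) (e v)) π' ∧ IsRegular π' ∧
      π'.length ≤ π.length ∧
      ∀ l' ∈ π', ∃ l ∈ π,
      (negSupport a k l'.clause).card ≤ (negSupport n k l.clause).card ∧
      ∀ v ∈ negSupport n k l.clause, v ∈ Set.range e) →
    ∀ τ γ : ℝ, 0 < τ → τ < 1 → 0 < γ → ∃ ε₁ : ℝ, 0 < ε₁ ∧ ∃ m₁ : ℕ, ∀ m : ℕ, m₁ ≤ m →
    ∀ (adj : Fin m → Fin m → Bool) (k : ℕ) (π : List (ResLine ℕ)),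
    IsResRefutation (cliqueCNF m k adj) π → IsRegular π →
    Real.logb 2 π.length ≤ ε₁ * Real.logb 2 m ^ 2 →
    ∃ (a : ℕ) (e : Fin a ↪ Fin m) (π' : List (ResLine ℕ)),
    (1 - τ) * Real.logb 2 m ≤ Real.logb 2 a ∧
    IsResRefutation (cliqueCNF a k fun u v => adj (e u) (e v)) π' ∧ IsRegular π' ∧
    π'.length ≤ π.length ∧
    ∀ l ∈ π', ((negSupport a k l.clause).card : ℝ) ≤ γ * Real.logb 2 a :=
  stub_oneWidthNF

end Summit.PneNP.PneNP.Cruxes.RegularResolutionRung.IndelibleZeroBanks
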